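import Mathlib
import Summits.NavierStokesRegularity.NavierStokesRegularity.Theorems.EulerZoomLiouvillePowerGaugeEulerLiouvillePastFastClock
import HarnessLib

/-!
# Crux E `PowerGaugeEulerLiouville` (stmt-NavierStokesRegularity-19832): SLOW power clocks about the final time are trivial

Route `EulerZoomLiouville` (NavierStokesRegularity), crux E = Seregin's power-gauged ancient-Euler Liouville statement.
Companion of `…PastFastClock` (`PastShape.ae_eq_zero_of_gauge_of_fastClockPast`, the shape-preserving ENGINE): a member of
the class (`0 < ρ ≤ ½`) that is EXACTLY SELF-SIMILAR ABOUT THE FINAL TIME `0` WITH A SLOW EXPONENT —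
`u(τ, y) = (−τ)^{g−1} V((−τ)^{−g} y)` for every `τ < 0`, `g < γ = 1/(2+ρ)`, `V : ℝ³ → ℝ³` arbitrary — vanishes a.e.:
as `τ → 0⁻` the `A`-gauge slice bound at the admissible scale `a = max(R,2)(−τ)^g` (`a² ≥ 4(−τ)^{2g} > −τ` for `−τ ≤ ½`,
`g < ½`) reads `∫_{B_R}|V|² ≤ c max(R,2)^{1−2ρ} (−τ)^{2 − g(4+2ρ)} → 0`.  Together with `…pastFastPowerClock`
(`g > ½ − ρ/5`, any `T₀`): of Euler's two-parameter family of power clocks only the exponents `g ∈ [γ, ½ − ρ/5]` survive the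
`A`-gauge arithmetic (`= {γ}` at `ρ = ½`); the class exponent `γ` is the registered self-similar residue of the lead skeleton.
WHAT THIS IS NOT: not NS regularity, not the crux E — a weak stratum for `Cruxes/PowerGaugeEulerLiouville/Lines/birth.lean`
(interim LEAD ns-typeII-p2 g10). [folklore; line card `Cruxes/PowerGaugeEulerLiouville/Lines/logtime-breathers.md` T4]
-/

noncomputable section

set_option linter.dupNamespace false

open MeasureTheory Set Filter Topology Metric Function
open scoped ENNReal NNReal

namespace Summit.NavierStokesRegularity.NavierStokesRegularity.Theorems.PowerGaugeEulerLiouville.PastShape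

open Literature.Analysis Literature.Analysis.FluidPDE

variable {ρ : ℝ} {u : ℝ → EuclideanSpace ℝ (Fin 3) → EuclideanSpace ℝ (Fin 3)}
  {p : ℝ → EuclideanSpace ℝ (Fin 3) → ℝ}
  {H : ℝ → EuclideanSpace ℝ (Fin 3) → EuclideanSpace ℝ (Fin 3) →L[ℝ] EuclideanSpace ℝ (Fin 3)} {c : ℝ≥0}

/-- **SLOW POWER CLOCKS ABOUT THE FINAL TIME are trivial.**  A member of the power-gauged class (`0 < ρ ≤ 1/2`) with
`u(τ, y) = (−τ)^{g−1} V((−τ)^{−g} y)` for every `τ < 0`, exponent `g < 1/(2+ρ)`, profile `V : ℝ³ → ℝ³` arbitrary, vanishes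
a.e. on the slab (the `A`-gauge as `τ → 0⁻`: `∫_{B_R}|V|² ≤ c max(R,2)^{1−2ρ} (−τ)^{2−g(4+2ρ)} → 0`). [folklore] -/
theorem ae_eq_zero_of_gauge_of_slowPowerClock (hρ : 0 < ρ) (hρh : ρ ≤ 1 / 2)
    (hsw : IsSuitableWeakSolutionOn (slab (EuclideanSpace ℝ (Fin 3)) (Iio 0) isOpen_Iio) 0 0 u p)
    (hH : HasWeakSpatialGradientOn (slab (EuclideanSpace ℝ (Fin 3)) (Iio 0) isOpen_Iio) u H)
    (hc : ∀ a : ℝ, 0 < a → ENNReal.ofReal (a ^ (2 * ρ)) * cknA a (0 : ℝ × EuclideanSpace ℝ (Fin 3)) u +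
        ENNReal.ofReal (a ^ ρ) * cknE a (0 : ℝ × EuclideanSpace ℝ (Fin 3)) H +
        ENNReal.ofReal (a ^ (2 * ρ)) * cknD a (0 : ℝ × EuclideanSpace ℝ (Fin 3)) p ≤ (c : ℝ≥0∞))
    {g : ℝ} (hg : g < 1 / (2 + ρ)) {V : EuclideanSpace ℝ (Fin 3) → EuclideanSpace ℝ (Fin 3)}
    (hu : ∀ τ : ℝ, τ < 0 → ∀ y, u τ y = (-τ) ^ (g - 1) • V ((-τ) ^ (-g) • y)) :
    uncurry u =ᵐ[volume.restrict (Iio (0 : ℝ) ×ˢ (univ : Set (EuclideanSpace ℝ (Fin 3))))] 0 := by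
  refine ae_eq_zero_of_gauge_of_fastClockPast hρ hsw hH hc le_rfl (θ := fun τ => (-τ) ^ (g - 1))
    (ℓ := fun τ => (-τ) ^ g) (V := V) (fun τ hτ => Real.rpow_pos_of_pos (by linarith) _)
    (fun τ hτ y => by rw [hu τ hτ y, Real.rpow_neg (by linarith : (0 : ℝ) ≤ -τ)]) ?_
  intro R hR ε hε
  have hρ2 : 0 < 2 + ρ := by linarith
  have hg2 : g < 1 / 2 := lt_of_lt_of_le hg (one_div_le_one_div_of_le two_pos (by linarith))
  -- the decay exponent `e' = 2 − g(4+2ρ) > 0`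
  set e : ℝ := 2 - g * (4 + 2 * ρ) with he
  have he0 : 0 < e := by
    have h1 : g * (2 + ρ) < 1 := by rwa [lt_div_iff₀ hρ2] at hg
    rw [he]; nlinarith
  set M : ℝ := max R 2 with hM
  have hM2 : 2 ≤ M := le_max_right _ _
  have hMR : R ≤ M := le_max_left _ _
  have hM0 : 0 < M := by linarith
  set K : ℝ := ε / M ^ (1 - 2 * ρ) with hK
  have hMp : 0 < M ^ (1 - 2 * ρ) := Real.rpow_pos_of_pos hM0 _
  have hK0 : 0 < K := div_pos hε hMp
  -- the time `τ = -s`, `s = min (1/2) (K^{1/e})`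
  set s : ℝ := min (1 / 2) (K ^ (1 / e)) with hs
  have hs0 : 0 < s := lt_min (by norm_num) (Real.rpow_pos_of_pos hK0 _)
  have hs12 : s ≤ 1 / 2 := min_le_left _ _
  have hs1 : s ≤ 1 := by linarith
  have hsK : s ≤ K ^ (1 / e) := min_le_right _ _
  have hτs : -(-s) = s := neg_neg s
  refine ⟨-s, by linarith, M * s ^ g, ?_, ?_, ?_⟩
  · -- `s < (M s^g)²`: `s^g ≥ s^{1/2}` for `s ≤ 1`, so `(M s^g)² ≥ 4 s > s`
    have h1 : s ^ (1 / 2 : ℝ) ≤ s ^ g := Real.rpow_le_rpow_of_exponent_ge hs0 hs1 hg2.le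
    have hsq : (s ^ (1 / 2 : ℝ)) ^ 2 = s := by
      rw [← Real.rpow_natCast, ← Real.rpow_mul hs0.le]; norm_num
    have h2 : s ≤ (s ^ g) ^ 2 :=
      calc s = (s ^ (1 / 2 : ℝ)) ^ 2 := hsq.symm
        _ ≤ (s ^ g) ^ 2 := pow_le_pow_left₀ (Real.rpow_nonneg hs0.le _) h1 2
    have h3 : (2 : ℝ) ^ 2 * (s ^ g) ^ 2 ≤ (M * s ^ g) ^ 2 := by
      rw [mul_pow]; gcongr
    rw [hτs]
    nlinarith
  · show R * (-(-s)) ^ g ≤ M * s ^ g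
    rw [hτs]
    gcongr
  · show (M * s ^ g) ^ (1 - 2 * ρ) ≤ ε * (((-(-s)) ^ (g - 1)) ^ 2 * ((-(-s)) ^ g) ^ 3)
    rw [hτs]
    have hsg0 : 0 ≤ s ^ g := Real.rpow_nonneg hs0.le _
    -- `θ² ℓ³ = s^{5g-2} = s^{-e} s^{g(1-2ρ)}`
    have hθℓ : (s ^ (g - 1)) ^ 2 * (s ^ g) ^ 3 = s ^ (-e) * s ^ (g * (1 - 2 * ρ)) := by
      rw [← Real.rpow_natCast (s ^ (g - 1)) 2, ← Real.rpow_natCast (s ^ g) 3, ← Real.rpow_mul hs0.le,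
        ← Real.rpow_mul hs0.le, ← Real.rpow_add hs0, ← Real.rpow_add hs0]
      congr 1
      rw [he]; push_cast; ring
    have hlhs : (M * s ^ g) ^ (1 - 2 * ρ) = M ^ (1 - 2 * ρ) * s ^ (g * (1 - 2 * ρ)) := by
      rw [Real.mul_rpow hM0.le hsg0, ← Real.rpow_mul hs0.le]
    rw [hθℓ, hlhs, ← mul_assoc]
    have hpos : 0 ≤ s ^ (g * (1 - 2 * ρ)) := Real.rpow_nonneg hs0.le _
    gcongr
    -- `M^{1-2ρ} ≤ ε s^{-e}`, i.e. `s^e ≤ K`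
    have hse : s ^ e ≤ K := by
      have h1 : s ^ e ≤ (K ^ (1 / e)) ^ e := Real.rpow_le_rpow hs0.le hsK he0.le
      rwa [← Real.rpow_mul hK0.le, one_div_mul_cancel he0.ne', Real.rpow_one] at h1
    have hse0 : 0 < s ^ e := Real.rpow_pos_of_pos hs0 _
    rw [Real.rpow_neg hs0.le, hK] at *
    rw [le_div_iff₀ hMp] at hse
    calc M ^ (1 - 2 * ρ) = (s ^ e * M ^ (1 - 2 * ρ)) * (s ^ e)⁻¹ := by
          field_simp
      _ ≤ ε * (s ^ e)⁻¹ := by gcongr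

end Summit.NavierStokesRegularity.NavierStokesRegularity.Theorems.PowerGaugeEulerLiouville.PastShape
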